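import Summits.QuantumFields.YangMills.Theorems.UnitScaleTiltProp7OneFormAgmonExp
import Summits.QuantumFields.YangMills.Theorems.UnitScaleTiltProp7BlockDistanceWeights
import HarnessLib

/-!
# Route `UnitScaleTilt`, crux K1 «MinimiserStabilityRegPr» (stmt-QuantumFields-19200), EX face S46 — (L3′b), ONE-FORM STOREY, FILE A4b:
# **THE `L²` BLOCK DECAY OF THE ONE-FORM SOLUTION TOWARDS EVERY BLOCK — A4 ✓`blockDecay_oneForm_of_letters` RUN WITH THE FINE-SCALE AGMON PHASE `φ_v(x) = rη·max(0, |x − x_v|₁ − 3ℓ)`**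
# = the `hD` letter of O4-KNIT ✓`pointwiseDecay_oneForm_knit` ∕ O4-E2E, displayed ONLY by (γ) coercivity, (C_V) and a θ_V UNIFORM over `rη`-Lipschitz phases

Cell `ym3-torus` (HUMAN RULING D-0037; rung R3 = SU(2) YM₃ on T³ — NOT d = 4, NOT infinite volume, NOT a mass gap, NOT Clay).  Chair seat ★`ym-ust-19200-p1` g26, own pen A4b.
THEOREMS ONLY (0 `def`, 0 `sorry`, default heartbeats); `--supports stmt-QuantumFields-19200 --as helper`; count-neutral.

THE PHASE.  The rate must be spent at the FINE scale: `φ_v(x) := rη·max(0, tdist(x, x_v) − 3ℓ)` (`x_v` any site of the source block `v`, `ℓ = L^{K−n}`, `ηℓ = 1`) is `rη`-Lipschitz per fine bond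
(so A4's price `3η⁻²(e^{rη} − 1)²(1 + 1∕ε) ≤ 3r²e^{2r}(1 + 1∕ε)` is K-FREE), vanishes on the source block (block diameter `≤ 3(ℓ − 1)`), and on the block `y` it is `≥ r·tdist(y, v) − 6r`
(✓`tdist_iterBlockOf_le`: `ℓ·(tdist(y,v) − 3) ≤ |x − x_v|₁`).  A coarse phase `r·tdist(B(x), v)` would jump by `r` across block faces and cost `3ℓ²(e^r − 1)²` — K-dependent; hence this file.
WHAT IS PROVED (ns `Summit.QuantumFields.YangMills.Theorems.Prop7OneFormBlockDecayAll`).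
* `abs_phase_sub_le` ∕ `abs_phase_sub_le_tdist` — the phase is `rη`-Lipschitz per fine bond ∕ in the fine `ℓ¹` distance; `phase_eq_zero_of_block` — it vanishes on the source block; `phase_ge_of_block` — `r·tdist(y,v) − 6r ≤ φ_v` on block `y`;
  `eta_sq_exp_sub_one_sq_le` — `η⁻²(e^{rη} − 1)² ≤ r²e^{2r}` (`0 ≤ r`, `η ≤ 1`; `e^x − 1 ≤ xe^x`).
* ★★★ `blockDecay_allBlocks_of_letters` — for `Δ_a u = toL2 X_f`, `X_f` supported on the bonds of block `v`, and the A4 letters (γ) `hco`, (C_V) `hVlow`, (θ_V) `hVconj` for EVERY phase that is `rη`-Lipschitz in the FINE `ℓ¹` distance (px21 g14's class (i′), A2g-fed):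
  `∀ y, Θ_r·‖toL2(1_{B = y}·toL2⁻¹u)‖ ≤ e^{6r}·e^{−r·tdist(y, v)}·‖toL2 X_f‖`, `Θ_r = (1−ε)γ − εC_V − 3η⁻²(e^{rη}−1)²(1+1∕ε) − θ_V` — i.e. `hD` with `D₀ = e^{6r}‖toL2 X_f‖∕Θ_r`.
HONEST SCOPE.  Bookkeeping over A4; CONDITIONAL on (γ) — the one-form coercivity, OPEN —, (C_V), (θ_V); nothing of the ten EX rows, `hT`, (3.42), EX or the crux is proved here.

References: T. Bałaban, CMP **99** (1985) 389–434 [Balaban1985BackgroundPropagators] (Thm 3.1 (3.42) p.397, (3.46) p.398, (3.49) p.399); S. Agmon (1982) Ch. 1 [folklore].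
-/

set_option autoImplicit false

noncomputable section

open scoped Matrix.Norms.L2Operator BigOperators InnerProductSpace ComplexConjugate

namespace Summit.QuantumFields.YangMills.Theorems.Prop7OneFormBlockDecayAll

open Literature.MathematicalPhysics.QuantumFieldTheory.Balaban1983to89
open Literature.MathematicalPhysics.QuantumFieldTheory.Balaban1983to89.T3ContinuumYM3Torus
open T3SectALandauChart (formComp eta eta_pos)
open B11Eq103H1Complex (BondL2K)
open B5Eq118OneStroke (iterBlockOf iterBlock mem_iterBlock card_iterBlock)
open B3Taylor310LocalRemainder (tdist_comm tdist_triangle)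
open Summit.QuantumFields.YangMills.Theorems.Prop7SectET3Transport (periodsT3)
open Summit.QuantumFields.YangMills.Theorems.Prop7SectET3HilbertLetters (W₂ toL2 toL2S DL2)
open Summit.QuantumFields.YangMills.Theorems.Prop7SectET3CurvedPropagators (laplaceA)
open Summit.QuantumFields.YangMills.Theorems.Prop7BlockDistanceWeights (tdist_iterBlockOf_le tdist_le_of_iterBlockOf_eq tdist_src_tgt_le_one eta_mul_pow_eq_one)
open Summit.QuantumFields.YangMills.Theorems.Prop7OneFormAgmonExp (blockDecay_oneForm_of_letters)

variable (F : T3Family) (n K : ℕ)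

/-! ## §1 The fine-scale phase -/

/-- The phase `x ↦ rη·max(0, |x − x_v|₁ − c)` is `rη`-Lipschitz along every fine bond (`0 ≤ r`). [folklore] -/
theorem abs_phase_sub_le {r : ℝ} (hr : 0 ≤ r) (c : ℝ) (xv : Site (F.P K) 0) (b : PBond (F.P K) 0) :
    |r * eta F n K * max 0 ((Site.tdist b.tgt xv : ℝ) - c) - r * eta F n K * max 0 ((Site.tdist b.src xv : ℝ) - c)| ≤ r * eta F n K := by
  have hη : 0 < eta F n K := eta_pos F n K
  rw [← mul_sub, abs_mul, abs_of_nonneg (by positivity : 0 ≤ r * eta F n K)]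
  refine mul_le_of_le_one_right (by positivity) ?_
  have key : |max 0 ((Site.tdist b.tgt xv : ℝ) - c) - max 0 ((Site.tdist b.src xv : ℝ) - c)|
      ≤ |((Site.tdist b.tgt xv : ℝ) - c) - ((Site.tdist b.src xv : ℝ) - c)| := by
    rw [max_comm (0 : ℝ) ((Site.tdist b.tgt xv : ℝ) - c), max_comm (0 : ℝ) ((Site.tdist b.src xv : ℝ) - c)]
    exact abs_max_sub_max_le_abs _ _ _
  refine key.trans ?_
  have h1 : (Site.tdist b.tgt xv : ℝ) ≤ Site.tdist b.src xv + 1 := by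
    have := tdist_triangle b.tgt b.src xv
    have h2 : Site.tdist b.tgt b.src ≤ 1 := by rw [tdist_comm]; exact tdist_src_tgt_le_one b
    exact_mod_cast this.trans (by omega)
  have h3 : (Site.tdist b.src xv : ℝ) ≤ Site.tdist b.tgt xv + 1 := by
    have := tdist_triangle b.src b.tgt xv
    have h2 : Site.tdist b.src b.tgt ≤ 1 := tdist_src_tgt_le_one b
    exact_mod_cast this.trans (by omega)
  rw [abs_le]; constructor <;> linarith

/-- The phase `x ↦ rη·max(0, |x − x_v|₁ − c)` is `rη`-Lipschitz for the FINE `ℓ¹` distance: `|φ x − φ x′| ≤ rη·|x − x′|₁` (px21 g14's class (i′)). [folklore] -/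
theorem abs_phase_sub_le_tdist {r : ℝ} (hr : 0 ≤ r) (c : ℝ) (xv x x' : Site (F.P K) 0) :
    |r * eta F n K * max 0 ((Site.tdist x xv : ℝ) - c) - r * eta F n K * max 0 ((Site.tdist x' xv : ℝ) - c)|
      ≤ r * eta F n K * (Site.tdist x x' : ℝ) := by
  have hη : 0 < eta F n K := eta_pos F n K
  rw [← mul_sub, abs_mul, abs_of_nonneg (by positivity : 0 ≤ r * eta F n K)]
  refine mul_le_mul_of_nonneg_left ?_ (by positivity)
  have key : |max 0 ((Site.tdist x xv : ℝ) - c) - max 0 ((Site.tdist x' xv : ℝ) - c)|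
      ≤ |((Site.tdist x xv : ℝ) - c) - ((Site.tdist x' xv : ℝ) - c)| := by
    rw [max_comm (0 : ℝ) ((Site.tdist x xv : ℝ) - c), max_comm (0 : ℝ) ((Site.tdist x' xv : ℝ) - c)]
    exact abs_max_sub_max_le_abs _ _ _
  refine key.trans ?_
  have h1 : (Site.tdist x xv : ℝ) ≤ Site.tdist x x' + Site.tdist x' xv := by exact_mod_cast tdist_triangle x x' xv
  have h2 : (Site.tdist x' xv : ℝ) ≤ Site.tdist x' x + Site.tdist x xv := by exact_mod_cast tdist_triangle x' x xv
  have h3 : (Site.tdist x' x : ℝ) = Site.tdist x x' := by exact_mod_cast tdist_comm x' x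
  rw [abs_le]; constructor <;> linarith

/-- The phase vanishes on the source block: if `B(x) = B(x_v)` then `|x − x_v|₁ ≤ 3(ℓ − 1) ≤ 3ℓ`. [cite: Balaban1985Averaging, (2) p.17] -/
theorem phase_eq_zero_of_block (hnK : n ≤ K) {r : ℝ} {xv x : Site (F.P K) 0} (hx : iterBlockOf (K - n) x = iterBlockOf (K - n) xv) :
    r * eta F n K * max 0 ((Site.tdist x xv : ℝ) - 3 * (F.L : ℝ) ^ (K - n)) = 0 := by
  have hk : K - n ≤ (F.P K).m + (F.P K).K := by show K - n ≤ F.m + K; have := F.hm; omega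
  have h1 := tdist_le_of_iterBlockOf_eq hk hx
  have h2 : (Site.tdist x xv : ℝ) ≤ 3 * (F.L : ℝ) ^ (K - n) := by
    have h3 : Site.tdist x xv ≤ 3 * F.L ^ (K - n) := h1.trans (by rw [T3Family.P_d]; exact Nat.mul_le_mul_left _ (Nat.sub_le _ _))
    exact_mod_cast h3
  rw [max_eq_left (by linarith), mul_zero]

/-- On the block `y` the phase is at least `r·tdist(y, B(x_v)) − 6r` (`ℓ(tdist_c − 3) ≤ |x − x_v|₁`, `ηℓ = 1`). [cite: Balaban1985Averaging, (2) p.17; Balaban1985BackgroundPropagators, (3.49) p.399] -/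
theorem phase_ge_of_block (hnK : n ≤ K) {r : ℝ} (hr : 0 ≤ r) (xv x : Site (F.P K) 0) :
    r * (Site.tdist (iterBlockOf (K - n) x) (iterBlockOf (K - n) xv) : ℝ) - 6 * r
      ≤ r * eta F n K * max 0 ((Site.tdist x xv : ℝ) - 3 * (F.L : ℝ) ^ (K - n)) := by
  have hk : K - n ≤ (F.P K).m + (F.P K).K := by show K - n ≤ F.m + K; have := F.hm; omega
  have hη : 0 < eta F n K := eta_pos F n K
  have hηℓ : eta F n K * (F.L : ℝ) ^ (K - n) = 1 := eta_mul_pow_eq_one F (n := n) (K := K)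
  have hℓ : 0 < (F.L : ℝ) ^ (K - n) := pow_pos (by exact_mod_cast (F.P K).L_pos) _
  -- `ℓ·tdist_c ≤ tdist + 3ℓ` in `ℕ`, hence in `ℝ`
  have hnat := tdist_iterBlockOf_le hk x xv
  have h1 : (F.L : ℝ) ^ (K - n) * (Site.tdist (iterBlockOf (K - n) x) (iterBlockOf (K - n) xv) : ℝ) ≤ (Site.tdist x xv : ℝ) + 3 * (F.L : ℝ) ^ (K - n) := by
    have h2 : F.L ^ (K - n) * Site.tdist (iterBlockOf (K - n) x) (iterBlockOf (K - n) xv) ≤ Site.tdist x xv + 3 * F.L ^ (K - n) := by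
      calc F.L ^ (K - n) * Site.tdist (iterBlockOf (K - n) x) (iterBlockOf (K - n) xv)
          ≤ F.L ^ (K - n) * (Site.tdist x xv / F.L ^ (K - n) + 3) := by
            refine Nat.mul_le_mul_left _ (hnat.trans ?_); rw [T3Family.P_d]; exact le_of_eq rfl
        _ = F.L ^ (K - n) * (Site.tdist x xv / F.L ^ (K - n)) + 3 * F.L ^ (K - n) := by ring
        _ ≤ Site.tdist x xv + 3 * F.L ^ (K - n) := Nat.add_le_add_right (Nat.mul_div_le _ _) _
    exact_mod_cast h2
  -- so `r·tdist_c − 6r ≤ rη·(tdist − 3ℓ) ≤ rη·max 0 (tdist − 3ℓ)`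
  have h3 : r * (Site.tdist (iterBlockOf (K - n) x) (iterBlockOf (K - n) xv) : ℝ) - 6 * r
      ≤ r * eta F n K * ((Site.tdist x xv : ℝ) - 3 * (F.L : ℝ) ^ (K - n)) := by
    have e : r * (Site.tdist (iterBlockOf (K - n) x) (iterBlockOf (K - n) xv) : ℝ) - 6 * r
        = r * eta F n K * ((F.L : ℝ) ^ (K - n) * (Site.tdist (iterBlockOf (K - n) x) (iterBlockOf (K - n) xv) : ℝ) - 6 * (F.L : ℝ) ^ (K - n)) := by
      have : r * eta F n K * ((F.L : ℝ) ^ (K - n) * (Site.tdist (iterBlockOf (K - n) x) (iterBlockOf (K - n) xv) : ℝ) - 6 * (F.L : ℝ) ^ (K - n))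
          = r * (eta F n K * (F.L : ℝ) ^ (K - n)) * ((Site.tdist (iterBlockOf (K - n) x) (iterBlockOf (K - n) xv) : ℝ) - 6) := by ring
      rw [this, hηℓ]; ring
    rw [e]
    exact mul_le_mul_of_nonneg_left (by linarith) (by positivity)
  exact h3.trans (mul_le_mul_of_nonneg_left (le_max_right _ _) (by positivity))

/-- `η⁻²(e^{rη} − 1)² ≤ r²e^{2r}` for `0 ≤ r` (`η ≤ 1`; `e^x − 1 ≤ x·e^x` for `x ≥ 0`). [folklore] -/
theorem eta_sq_exp_sub_one_sq_le {r : ℝ} (hr : 0 ≤ r) :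
    ((eta F n K)⁻¹) ^ 2 * (Real.exp (r * eta F n K) - 1) ^ 2 ≤ r ^ 2 * Real.exp (2 * r) := by
  have hη : 0 < eta F n K := eta_pos F n K
  have hη1 : eta F n K ≤ 1 := by
    rw [T3SectALandauChart.eta]
    exact pow_le_one₀ (by positivity) (inv_le_one_of_one_le₀ (by exact_mod_cast (F.P K).L_pos))
  -- `e^x − 1 ≤ x·e^x` for `x ≥ 0` (from `1 − x ≤ e^{−x}`), at `x = rη ≤ r`
  set x : ℝ := r * eta F n K with hx
  have hx0 : 0 ≤ x := by positivity
  have hxr : x ≤ r := by rw [hx]; nlinarith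
  have h1 : Real.exp x - 1 ≤ x * Real.exp x := by
    have h := Real.add_one_le_exp (-x)
    have he : Real.exp (-x) * Real.exp x = 1 := by rw [← Real.exp_add, neg_add_cancel, Real.exp_zero]
    nlinarith [Real.exp_pos x, Real.exp_pos (-x)]
  have h0 : 0 ≤ Real.exp x - 1 := by linarith [Real.add_one_le_exp x]
  have h2 : Real.exp x - 1 ≤ x * Real.exp r := h1.trans (mul_le_mul_of_nonneg_left (Real.exp_le_exp.mpr hxr) hx0)
  have h3 : (Real.exp x - 1) ^ 2 ≤ (x * Real.exp r) ^ 2 := pow_le_pow_left₀ h0 h2 2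
  calc ((eta F n K)⁻¹) ^ 2 * (Real.exp x - 1) ^ 2 ≤ ((eta F n K)⁻¹) ^ 2 * (x * Real.exp r) ^ 2 :=
        mul_le_mul_of_nonneg_left h3 (by positivity)
    _ = r ^ 2 * Real.exp (2 * r) := by
        have e2 : Real.exp (2 * r) = Real.exp r ^ 2 := by rw [← Real.exp_nat_mul]; norm_num
        rw [e2, hx]; field_simp

/-! ## §2 The block decay towards every block -/

variable {F n K}
variable {c₀ : ℝ} [Fact (0 < c₀)] {h : n ≤ K} {cB a : ℝ} [Fact (0 < cB)]
  {Δx : GaugeField (F.P K) 0 (Matrix.specialUnitaryGroup (Fin 2) ℂ) → (BondL2K ℂ 3 (periodsT3 F K) c₀ W₂ →ₗ[ℂ] BondL2K ℂ 3 (periodsT3 F K) c₀ W₂)}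

/-- ★★★ **THE `L²` BLOCK DECAY OF THE ONE-FORM SOLUTION TOWARDS EVERY BLOCK.**  `Δ_a u = toL2 X_f` with `X_f` supported on the bonds whose source lies in the block `v`; the A4 letters:
(γ) `hco`, (C_V) `hVlow`, and (θ_V) `hVconj` for EVERY phase `φ` with `|φ x − φ x′| ≤ rη·|x − x′|₁` (px21 g14's A2g ✓-feeds this class uniformly); THEN for every block `y`
`Θ_r·‖toL2(1_{B = y}·toL2⁻¹u)‖ ≤ e^{6r}·e^{−r·tdist(y, v)}·‖toL2 X_f‖`, `Θ_r = (1−ε)γ − εC_V − 3η⁻²(e^{rη}−1)²(1+1∕ε) − θ_V` (`≥ (1−ε)γ − εC_V − 3r²e^{2r}(1+1∕ε) − θ_V`, §1) —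
A4 ✓`blockDecay_oneForm_of_letters` at the phase `rη·max(0, |x − x_v|₁ − 3ℓ)`.  The `hD` letter of O4-KNIT∕E2E with `D₀ = e^{6r}‖toL2 X_f‖∕Θ_r`.  CONDITIONAL on (γ)(C_V)(θ_V).
[cite: Balaban1985BackgroundPropagators, Thm 3.1 (3.42) p.397, (3.46) p.398, (3.49) p.399] -/
theorem blockDecay_allBlocks_of_letters (hnK : n ≤ K) (U₀ : GaugeField (F.P K) 0 (Matrix.specialUnitaryGroup (Fin 2) ℂ)) {r : ℝ} (hr : 0 ≤ r)
    {γ CV θV ε : ℝ} (hε : 0 < ε) (hε1 : ε ≤ 1)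
    (hco : ∀ v : BondL2K ℂ 3 (periodsT3 F K) c₀ W₂, γ * ‖v‖ ^ 2 ≤ RCLike.re ⟪v, laplaceA F n K h c₀ cB a Δx U₀ v⟫_ℂ)
    (hVlow : ∀ X : PBond (F.P K) 0 → Matrix (Fin 2) (Fin 2) ℂ,
      -(CV * ‖toL2 F K c₀ X‖ ^ 2) ≤ RCLike.re ⟪toL2 F K c₀ X, laplaceA F n K h c₀ cB a Δx U₀ (toL2 F K c₀ X)⟫_ℂ
        - ∑ μ : Fin (F.P K).d, ‖DL2 F n K c₀ U₀ (toL2S F K c₀ (formComp X μ))‖ ^ 2)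
    (hVconj : ∀ φ : Site (F.P K) 0 → ℝ, (∀ x x' : Site (F.P K) 0, |φ x - φ x'| ≤ r * eta F n K * (Site.tdist x x' : ℝ)) →
      ∀ X : PBond (F.P K) 0 → Matrix (Fin 2) (Fin 2) ℂ,
      RCLike.re ⟪toL2 F K c₀ X, laplaceA F n K h c₀ cB a Δx U₀ (toL2 F K c₀ X)⟫_ℂ
          - (∑ μ : Fin (F.P K).d, ‖DL2 F n K c₀ U₀ (toL2S F K c₀ (formComp X μ))‖ ^ 2) - θV * ‖toL2 F K c₀ X‖ ^ 2
        ≤ RCLike.re ⟪toL2 F K c₀ (fun b => Real.exp (φ b.src) • X b), laplaceA F n K h c₀ cB a Δx U₀ (toL2 F K c₀ (fun b => (Real.exp (φ b.src))⁻¹ • X b))⟫_ℂ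
          - RCLike.re (∑ μ : Fin (F.P K).d, ⟪DL2 F n K c₀ U₀ (toL2S F K c₀ (formComp (fun b => Real.exp (φ b.src) • X b) μ)),
              DL2 F n K c₀ U₀ (toL2S F K c₀ (formComp (fun b => (Real.exp (φ b.src))⁻¹ • X b) μ))⟫_ℂ))
    (hΘ : 0 ≤ (1 - ε) * γ - ε * CV - 3 * ((eta F n K)⁻¹) ^ 2 * (Real.exp (r * eta F n K) - 1) ^ 2 * (1 + 1 / ε) - θV)
    (Xf : PBond (F.P K) 0 → Matrix (Fin 2) (Fin 2) ℂ) (v : Site (F.P K) (K - n)) (hXf : ∀ b, Xf b ≠ 0 → iterBlockOf (K - n) b.src = v)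
    (u : BondL2K ℂ 3 (periodsT3 F K) c₀ W₂) (hu : laplaceA F n K h c₀ cB a Δx U₀ u = toL2 F K c₀ Xf) (y : Site (F.P K) (K - n)) :
    ((1 - ε) * γ - ε * CV - 3 * ((eta F n K)⁻¹) ^ 2 * (Real.exp (r * eta F n K) - 1) ^ 2 * (1 + 1 / ε) - θV)
        * ‖toL2 F K c₀ (fun b => if iterBlockOf (K - n) b.src = y then (toL2 F K c₀).symm u b else 0)‖
      ≤ Real.exp (6 * r) * Real.exp (-(r * (Site.tdist y v : ℝ))) * ‖toL2 F K c₀ Xf‖ := by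
  classical
  have hk : K - n ≤ (F.P K).m + (F.P K).K := by show K - n ≤ F.m + K; have := F.hm; omega
  -- a reference site of the source block
  obtain ⟨xv, hxv⟩ : ∃ xv : Site (F.P K) 0, iterBlockOf (K - n) xv = v := by
    have hc : 0 < (iterBlock (K - n) v).card := by
      rw [card_iterBlock (K - n) hk v]; exact pow_pos (pow_pos (F.P K).L_pos _) _
    obtain ⟨x, hx⟩ := Finset.card_pos.mp hc
    exact ⟨x, (mem_iterBlock (K - n) v x).mp hx⟩
  set φ : Site (F.P K) 0 → ℝ := fun x => r * eta F n K * max 0 ((Site.tdist x xv : ℝ) - 3 * (F.L : ℝ) ^ (K - n)) with hφdef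
  have hφ : ∀ b : PBond (F.P K) 0, |φ b.tgt - φ b.src| ≤ r * eta F n K := fun b => abs_phase_sub_le F n K hr _ xv b
  have hφ' : ∀ x x' : Site (F.P K) 0, |φ x - φ x'| ≤ r * eta F n K * (Site.tdist x x' : ℝ) := fun x x' => abs_phase_sub_le_tdist F n K hr _ xv x x'
  have hXf' : ∀ b, Xf b ≠ 0 → φ b.src = 0 := fun b hb =>
    phase_eq_zero_of_block F n K hnK (by rw [hXf b hb, hxv])
  -- A4 on the set `{b | B b.src = y}` with `R := r·tdist(y,v) − 6r`
  have hS : ∀ b ∈ {b : PBond (F.P K) 0 | iterBlockOf (K - n) b.src = y}, r * (Site.tdist y v : ℝ) - 6 * r ≤ φ b.src := by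
    intro b hb
    rw [Set.mem_setOf_eq] at hb
    have := phase_ge_of_block F n K hnK hr xv b.src
    rw [hb, hxv] at this
    exact this
  have hA := blockDecay_oneForm_of_letters (h := h) (cB := cB) (a := a) (Δx := Δx) U₀ φ hφ hε hε1 hco hVlow (hVconj φ hφ') hΘ Xf hXf' u hu
    {b : PBond (F.P K) 0 | iterBlockOf (K - n) b.src = y} hS
  have e : Real.exp (-(r * (Site.tdist y v : ℝ) - 6 * r)) = Real.exp (6 * r) * Real.exp (-(r * (Site.tdist y v : ℝ))) := by
    rw [← Real.exp_add]; ring_nf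
  rw [e] at hA
  have hfun : (fun b : PBond (F.P K) 0 => if iterBlockOf (K - n) b.src = y then (toL2 F K c₀).symm u b else 0)
      = fun b => if b ∈ {b : PBond (F.P K) 0 | iterBlockOf (K - n) b.src = y} then (toL2 F K c₀).symm u b else 0 := by
    funext b; simp only [Set.mem_setOf_eq]
  rw [hfun]; exact hA

end Summit.QuantumFields.YangMills.Theorems.Prop7OneFormBlockDecayAll

end
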